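import Literature.Computability.QuantumComplexity.ForrelationCompleteProofs
import Literature.NumberTheory.LFunctions.TaoLogElliottHoeffding
import HarnessLib

/-!
# Concentration of `k`-fold Forrelation under uniformly random functions
# (Aaronson–Ambainis, Lemma 34, in sub-Gaussian form)

Reproduction (trunk `Literature/Computability/QuantumComplexity`; solo seat
`solo-QuantumAdvantage-informed`, session 10) of

* S. Aaronson, A. Ambainis, *Forrelation: a problem that optimally separates quantum from
  classical computing*, SIAM J. Comput. 47(3) (2018) 982–1038 = arXiv:1411.5729 (held text
  `paper:arxiv-1411.5729`; Appendix "Lower bound for `k`-fold Forrelation", §9.1 "Concentration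
  inequalities", **Lemma 34**, arXiv p. 35): "Suppose `f₁,…,f_k : {0,1}ⁿ → {−1,1}` are chosen
  uniformly at random. Then `Pr[|Φ_{f₁,…,f_k}| ≥ t/√N] = O(1/tᵗ)`." Printed proof: "Imagine that
  `f₁,…,f_{k−1}` are fixed, so that we are considering `Φ_{f₁,…,f_k}` solely as a function of
  `f_k`. We have `Φ = N^{-1/2} ∑ₓ αₓ f_k(x)` where … `∑ₓ αₓ² = 1`. … We now appeal to Bennett's
  inequality".

What is reproduced, over the tree's `kForrelationValue` and `forrelationCircuit`
(`ForrelationCompleteProofs.lean`: `Φ = ⟨0ⁿ| H^{⊗n} U_{f_k} H^{⊗n} ⋯ U_{f₁} H^{⊗n} |0ⁿ⟩`, a unitary):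

* `kForrelationValue_snoc_eq_sum` — the printed linearisation in the last function: for fixed
  `g = (f₁,…,f_k)` and a last function `h`, `Φ(g,h) = ∑_y (−1)^{h(y)} a_g(y)` with
  `a_g(y) = 2^{-n/2} Re ⟨y|C_g|0ⁿ⟩` (the paper's `αₓ/√N`), `C_g` the Forrelation circuit of `g`;
* `sum_norm_sq_forrelationCircuit_col`, `sum_lastCoeffBound_sq` — the paper's `∑ₓ αₓ² = 1`: the
  first column of the unitary `C_g` is a unit vector, so `∑_y (2^{-n/2}‖⟨y|C_g|0ⁿ⟩‖)² = 2^{-n}`;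
* `card_filter_le_kForrelationValue_snoc`, `card_filter_le_neg_kForrelationValue_snoc`,
  `card_filter_le_abs_kForrelationValue_snoc` — **VARIANT of Lemma 34 (conditional, sub-Gaussian
  form)**: for every fixed `g` and every `t ≥ 0`, `#{h : t ≤ Φ(g,h)} ≤ exp(−t²·2ⁿ/2) · 2^{2ⁿ}`
  (likewise for `−Φ`; twice that for `|Φ|`), by Hoeffding's inequality in the tree's counting form
  (`Literature.NumberTheory.LFunctions.Tao2016.hoeffding_count_pi`) in place of Bennett's;
* `card_filter_le_abs_kForrelationValue`, `card_filter_sqrt_le_abs_kForrelationValue` — the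
  unconditional statement over all `(k+1)`-tuples, `#{f : t ≤ |Φ_f|} ≤ 2 exp(−t²·2ⁿ/2) · 2^{(k+1)2ⁿ}`,
  and the paper's normalisation `t = s/√(2ⁿ)`: `#{f : s/√N ≤ |Φ_f|} ≤ 2 e^{−s²/2} · #{all f}`.
  This implies the printed `O(1/tᵗ)` (indeed `e^{-s²/2} ≤ e^{-h(s)}`, `h(s) = (1+s)ln(1+s) − s`,
  Bennett's exponent with the crude range bound `|αₓ| ≤ 1`) — variant noted: the constant in the
  paper's `O(·)` is not tracked, the exponent is improved.

Consumer: the solo seat's door table for `QuantumAdvantage` (random-oracle cell Q-R,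
`Summits/QuantumAdvantage/QuantumAdvantage/Theorems/SoloInformedThickWitness.lean`): under a
uniformly random oracle the law of `k`-fold Forrelation is sub-Gaussian with variance proxy `2^{-n}`
for EVERY `k`, hence its gap problem is THIN (tail masses summable over input lengths as soon as
`2ⁿ` grows faster than the input length) — it is not a candidate for a thick random-oracle promise
separation.

## References
* [AaronsonAmbainis2018] S. Aaronson, A. Ambainis, *Forrelation: a problem that optimally
  separates quantum from classical computing*, SIAM J. Comput. 47(3):982–1038, 2018
  (arXiv:1411.5729), Appendix §9.1, Lemma 34.
* W. Hoeffding, *Probability inequalities for sums of bounded random variables*, J. Amer. Statist.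
  Assoc. 58 (1963) 13–30, Thm. 2 — in the tree as `Tao2016.hoeffding_count_pi`.
-/

noncomputable section

namespace Literature.Computability.QuantumComplexity

open Matrix Finset Cryptography

variable {n k : ℕ}

/-! ### The last function enters linearly -/

/-
Notation used in the docstrings below (no new definitions are introduced): for
`g = (f₁,…,f_k)` and `C_g = forrelationCircuit k g`,
`a_g(y) := 2^{-n/2} · Re ⟨y| C_g |0ⁿ⟩ = ((√2)⁻¹)^n * (C_g y 0ⁿ).re` (the paper's `αₓ/√N`) and
`c_g(y) := 2^{-n/2} · ‖⟨y| C_g |0ⁿ⟩‖` (the Hoeffding range of the `y`-th summand).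
-/

/-- The twist against the all-zero string on the left is `1`. [cite: AaronsonAmbainis2018, §3.2] -/
theorem twist_zero_left' (y : Fin n → Bool) : twist (fun _ => false) y = 1 := by
  rw [twist_comm, twist_zero_right]

/-- **Linearisation in the last function** (printed: "we are considering `Φ` solely as a function
of `f_k`. We have `Φ = N^{-1/2} ∑ₓ αₓ f_k(x)`"): `Φ(f₁,…,f_k,h) = ∑_y (−1)^{h(y)} a(y)`, read off
the matrix product `H^{⊗n} · U_h · C_g` at the entry `⟨0ⁿ|·|0ⁿ⟩`.
[cite: AaronsonAmbainis2018, §9.1 Lemma 34 (proof)] -/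
theorem kForrelationValue_snoc_eq_sum (g : Fin k → (Fin n → Bool) → Bool)
    (h : (Fin n → Bool) → Bool) :
    kForrelationValue (Fin.snoc g h : Fin (k + 1) → (Fin n → Bool) → Bool) =
      ∑ y, signOf (h y) * (((Real.sqrt 2)⁻¹) ^ n * (forrelationCircuit k g y (fun _ => false)).re) := by
  have key : ((kForrelationValue (Fin.snoc g h : Fin (k + 1) → (Fin n → Bool) → Bool) : ℝ) : ℂ) =
      ∑ y : QReg n, ((((Real.sqrt 2)⁻¹) ^ n * signOf (h y) : ℝ) : ℂ) *
        forrelationCircuit k g y (fun _ => false) := by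
    rw [← forrelationCircuit_apply_zero_zero, forrelationCircuit, Fin.snoc_last, Fin.init_snoc,
      Matrix.mul_apply]
    refine Finset.sum_congr rfl fun y _ => ?_
    simp only [phaseLayer, Matrix.mul_diagonal, hGateAll_apply_eq_twist, twist_zero_left']
    push_cast
    ring
  have hre := congrArg Complex.re key
  rw [Complex.ofReal_re, Complex.re_sum] at hre
  rw [hre]
  refine Finset.sum_congr rfl fun y _ => ?_
  rw [Complex.re_ofReal_mul]
  ring

/-- **The first column of the Forrelation circuit is a unit vector** (`C_g` is unitary):
`∑_y ‖⟨y|C_g|0ⁿ⟩‖² = 1` — the paper's "`∑ₓ αₓ² = 1`" (its eq. (ss)).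
[cite: AaronsonAmbainis2018, §9.1 Lemma 34 (proof)] -/
theorem sum_norm_sq_forrelationCircuit_col (g : Fin k → (Fin n → Bool) → Bool) :
    ∑ y, ‖forrelationCircuit k g y (fun _ => false)‖ ^ 2 = 1 := by
  have hU := forrelationCircuit_mem_unitaryGroup k g
  have h1 : (star (forrelationCircuit k g) * forrelationCircuit k g) (fun _ => false)
      (fun _ => false) = 1 := by
    rw [Matrix.mem_unitaryGroup_iff'.mp hU, Matrix.one_apply_eq]
  rw [Matrix.mul_apply] at h1
  simp only [Matrix.star_apply, Complex.star_def, Complex.conj_mul'] at h1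
  exact_mod_cast h1

/-- `(2^{-n/2})² = 2^{-n}`. [folklore] -/
theorem sqrt_two_inv_pow_sq (n : ℕ) : (((Real.sqrt 2)⁻¹) ^ n) ^ 2 = ((2 : ℝ) ^ n)⁻¹ := by
  rw [← pow_mul, pow_mul', inv_pow, Real.sq_sqrt (by norm_num : (0 : ℝ) ≤ 2), inv_pow]

/-- **`∑_y c_g(y)² = 2^{-n}`**: the sum of squared Hoeffding ranges is the variance proxy `1/N`.
[cite: AaronsonAmbainis2018, §9.1 Lemma 34 (proof)] -/
theorem sum_lastCoeffBound_sq (g : Fin k → (Fin n → Bool) → Bool) :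
    ∑ y : Fin n → Bool, (((Real.sqrt 2)⁻¹) ^ n * ‖forrelationCircuit k g y (fun _ => false)‖) ^ 2 = ((2 : ℝ) ^ n)⁻¹ := by
  simp only [mul_pow, ← Finset.mul_sum, sum_norm_sq_forrelationCircuit_col,
    mul_one, sqrt_two_inv_pow_sq]

/-- Each summand `(−1)^{b} a_g(y)` lies in `[−c_g(y), c_g(y)]` (`|Re z| ≤ ‖z‖`).
[cite: AaronsonAmbainis2018, §9.1 Lemma 34 (proof)] -/
theorem abs_signOf_mul_lastCoeff_le (g : Fin k → (Fin n → Bool) → Bool) (y : Fin n → Bool)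
    (b : Bool) : |signOf b * (((Real.sqrt 2)⁻¹) ^ n * (forrelationCircuit k g y (fun _ => false)).re)| ≤
      (((Real.sqrt 2)⁻¹) ^ n * ‖forrelationCircuit k g y (fun _ => false)‖) := by
  rw [abs_mul, abs_mul]
  have h1 : |signOf b| = 1 := by cases b <;> simp [signOf]
  have h2 : |((Real.sqrt 2)⁻¹) ^ n| = ((Real.sqrt 2)⁻¹) ^ n := abs_of_nonneg (by positivity)
  rw [h1, one_mul, h2]
  exact mul_le_mul_of_nonneg_left (Complex.abs_re_le_norm _) (by positivity)

/-! ### Hoeffding in the last function: the conditional tail bounds -/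

/-- Core Hoeffding step, for either sign `σ = ±1`: for fixed `g` and `t ≥ 0`,
`#{h : t ≤ σ·Φ(g,h)} ≤ exp(−t² 2ⁿ/2) · 2^{2ⁿ}`. [cite: AaronsonAmbainis2018, §9.1 Lemma 34 — variant (Hoeffding for Bennett)] -/
theorem card_filter_le_sign_mul_kForrelationValue_snoc (g : Fin k → (Fin n → Bool) → Bool)
    {σ : ℝ} (hσ : |σ| = 1) {t : ℝ} (ht : 0 ≤ t) :
    ((Finset.univ.filter fun h : (Fin n → Bool) → Bool =>
        t ≤ σ * kForrelationValue (Fin.snoc g h : Fin (k + 1) → (Fin n → Bool) → Bool)).card : ℝ) ≤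
      Real.exp (-(t ^ 2 * 2 ^ n / 2)) * 2 ^ (2 ^ n) := by
  -- the summands `σ (−1)^b a_g(y)` and their ranges `c_g(y)`
  set a : (Fin n → Bool) → ℝ := fun y =>
    ((Real.sqrt 2)⁻¹) ^ n * (forrelationCircuit k g y (fun _ => false)).re with ha
  set c : (Fin n → Bool) → ℝ := fun y =>
    ((Real.sqrt 2)⁻¹) ^ n * ‖forrelationCircuit k g y (fun _ => false)‖ with hc
  have hf0 : ∀ y : Fin n → Bool, ∑ b : Bool, σ * (signOf b * a y) = 0 := fun y => by
    simp [signOf]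
  have hfc : ∀ (y : Fin n → Bool) (b : Bool), |σ * (signOf b * a y)| ≤ c y :=
    fun y b => by
      rw [abs_mul, hσ, one_mul]
      exact abs_signOf_mul_lastCoeff_le g y b
  have hsum : ∑ y, c y ^ 2 = ((2 : ℝ) ^ n)⁻¹ := sum_lastCoeffBound_sq g
  have hS : 0 < ∑ y, c y ^ 2 := by
    rw [hsum]; positivity
  have H := Literature.NumberTheory.LFunctions.Tao2016.hoeffding_count_pi
    (κ := fun _ : (Fin n → Bool) => Bool) (fun y b => σ * (signOf b * a y)) c hf0 hfc ht hS
  rw [hsum] at H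
  simp only [Finset.prod_const, Finset.card_univ, Fintype.card_bool, Fintype.card_fun,
    Fintype.card_fin, Nat.cast_ofNat] at H
  have hexp : t ^ 2 / (2 * ((2 : ℝ) ^ n)⁻¹) = t ^ 2 * 2 ^ n / 2 := by
    field_simp
  rw [hexp] at H
  have hfilter : (Finset.univ.filter fun h : (Fin n → Bool) → Bool =>
        t ≤ σ * kForrelationValue (Fin.snoc g h : Fin (k + 1) → (Fin n → Bool) → Bool)) =
      (Finset.univ.filter fun h : (Fin n → Bool) → Bool =>
        t ≤ ∑ y, σ * (signOf (h y) * a y)) :=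
    Finset.filter_congr fun h _ => by rw [kForrelationValue_snoc_eq_sum, Finset.mul_sum]
  rw [hfilter]
  convert H using 2

/-- **Lemma 34, conditional upper tail (sub-Gaussian form).** For every fixed `g = (f₁,…,f_k)`
and `t ≥ 0`: `#{h : t ≤ Φ(f₁,…,f_k,h)} ≤ exp(−t²·2ⁿ/2) · 2^{2ⁿ}`, i.e.
`Pr_h[Φ ≥ t] ≤ e^{−t² N/2}`. [cite: AaronsonAmbainis2018, §9.1 Lemma 34 — variant (Hoeffding for Bennett)] -/
theorem card_filter_le_kForrelationValue_snoc (g : Fin k → (Fin n → Bool) → Bool) {t : ℝ}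
    (ht : 0 ≤ t) :
    ((Finset.univ.filter fun h : (Fin n → Bool) → Bool =>
        t ≤ kForrelationValue (Fin.snoc g h : Fin (k + 1) → (Fin n → Bool) → Bool)).card : ℝ) ≤
      Real.exp (-(t ^ 2 * 2 ^ n / 2)) * 2 ^ (2 ^ n) := by
  simpa only [one_mul] using
    card_filter_le_sign_mul_kForrelationValue_snoc g (σ := 1) (by simp) ht

/-- **Lemma 34, conditional lower tail (sub-Gaussian form).** For every fixed `g` and `t ≥ 0`:
`#{h : t ≤ −Φ(g,h)} ≤ exp(−t²·2ⁿ/2) · 2^{2ⁿ}`. [cite: AaronsonAmbainis2018, §9.1 Lemma 34 — variant (Hoeffding for Bennett)] -/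
theorem card_filter_le_neg_kForrelationValue_snoc (g : Fin k → (Fin n → Bool) → Bool) {t : ℝ}
    (ht : 0 ≤ t) :
    ((Finset.univ.filter fun h : (Fin n → Bool) → Bool =>
        t ≤ -kForrelationValue (Fin.snoc g h : Fin (k + 1) → (Fin n → Bool) → Bool)).card : ℝ) ≤
      Real.exp (-(t ^ 2 * 2 ^ n / 2)) * 2 ^ (2 ^ n) := by
  simpa only [neg_one_mul] using
    card_filter_le_sign_mul_kForrelationValue_snoc g (σ := -1) (by simp) ht

/-- **Lemma 34, conditional two-sided tail (sub-Gaussian form).** For every fixed `g` and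
`t ≥ 0`: `#{h : t ≤ |Φ(g,h)|} ≤ 2 exp(−t²·2ⁿ/2) · 2^{2ⁿ}`.
[cite: AaronsonAmbainis2018, §9.1 Lemma 34 — variant (Hoeffding for Bennett)] -/
theorem card_filter_le_abs_kForrelationValue_snoc (g : Fin k → (Fin n → Bool) → Bool) {t : ℝ}
    (ht : 0 ≤ t) :
    ((Finset.univ.filter fun h : (Fin n → Bool) → Bool =>
        t ≤ |kForrelationValue (Fin.snoc g h : Fin (k + 1) → (Fin n → Bool) → Bool)|).card : ℝ) ≤
      2 * Real.exp (-(t ^ 2 * 2 ^ n / 2)) * 2 ^ (2 ^ n) := by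
  set P : ((Fin n → Bool) → Bool) → Prop := fun h =>
    t ≤ kForrelationValue (Fin.snoc g h : Fin (k + 1) → (Fin n → Bool) → Bool) with hP
  set Q : ((Fin n → Bool) → Bool) → Prop := fun h =>
    t ≤ -kForrelationValue (Fin.snoc g h : Fin (k + 1) → (Fin n → Bool) → Bool) with hQ
  have hsub : (Finset.univ.filter fun h : (Fin n → Bool) → Bool =>
        t ≤ |kForrelationValue (Fin.snoc g h : Fin (k + 1) → (Fin n → Bool) → Bool)|) ⊆
      Finset.univ.filter P ∪ Finset.univ.filter Q := by
    intro h hh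
    simp only [Finset.mem_filter, Finset.mem_union, Finset.mem_univ, true_and, hP, hQ] at hh ⊢
    exact le_abs.mp hh
  calc ((Finset.univ.filter fun h : (Fin n → Bool) → Bool =>
        t ≤ |kForrelationValue (Fin.snoc g h : Fin (k + 1) → (Fin n → Bool) → Bool)|).card : ℝ)
      ≤ ((Finset.univ.filter P ∪ Finset.univ.filter Q).card : ℝ) := by
        exact_mod_cast Finset.card_le_card hsub
    _ ≤ ((Finset.univ.filter P).card : ℝ) + ((Finset.univ.filter Q).card : ℝ) := by
        exact_mod_cast Finset.card_union_le _ _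
    _ ≤ Real.exp (-(t ^ 2 * 2 ^ n / 2)) * 2 ^ (2 ^ n) +
          Real.exp (-(t ^ 2 * 2 ^ n / 2)) * 2 ^ (2 ^ n) :=
        add_le_add (card_filter_le_kForrelationValue_snoc g ht)
          (card_filter_le_neg_kForrelationValue_snoc g ht)
    _ = 2 * Real.exp (-(t ^ 2 * 2 ^ n / 2)) * 2 ^ (2 ^ n) := by ring

/-! ### All functions random -/

/-- Counting a filter over `(k+1)`-tuples by the last coordinate: `#{f : P f} = ∑_{g} #{h : P(g,h)}`.
[folklore] -/
theorem card_filter_tuple_succ {α : Type*} [Fintype α] [DecidableEq α]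
    (P : (Fin (k + 1) → α) → Prop) [DecidablePred P] :
    ((Finset.univ.filter P).card : ℝ) =
      ∑ g : Fin k → α, ((Finset.univ.filter fun h : α => P (Fin.snoc g h)).card : ℝ) := by
  have h1 : ((Finset.univ.filter P).card : ℝ) = ∑ f : Fin (k + 1) → α, if P f then (1 : ℝ) else 0 := by
    rw [Finset.card_filter]; push_cast; rfl
  rw [h1, sum_tuple_succ, Finset.sum_comm]
  refine Finset.sum_congr rfl fun g _ => ?_
  rw [Finset.card_filter]; push_cast; rfl

/-- **Lemma 34 (sub-Gaussian form), all `k+1` functions uniformly random.** For `t ≥ 0`,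
`#{(f₁,…,f_{k+1}) : t ≤ |Φ|} ≤ 2 exp(−t²·2ⁿ/2) · 2^{(k+1)·2ⁿ}`, i.e. `Pr[|Φ| ≥ t] ≤ 2e^{−t² N/2}`
under the uniform law on all tuples, for every number of functions.
[cite: AaronsonAmbainis2018, §9.1 Lemma 34 — variant (Hoeffding for Bennett)] -/
theorem card_filter_le_abs_kForrelationValue (k n : ℕ) {t : ℝ} (ht : 0 ≤ t) :
    ((Finset.univ.filter fun f : Fin (k + 1) → (Fin n → Bool) → Bool =>
        t ≤ |kForrelationValue f|).card : ℝ) ≤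
      2 * Real.exp (-(t ^ 2 * 2 ^ n / 2)) * 2 ^ ((k + 1) * 2 ^ n) := by
  rw [card_filter_tuple_succ]
  calc ∑ g : Fin k → (Fin n → Bool) → Bool,
        ((Finset.univ.filter fun h : (Fin n → Bool) → Bool =>
          t ≤ |kForrelationValue (Fin.snoc g h : Fin (k + 1) → (Fin n → Bool) → Bool)|).card : ℝ)
      ≤ ∑ _g : Fin k → (Fin n → Bool) → Bool, 2 * Real.exp (-(t ^ 2 * 2 ^ n / 2)) * 2 ^ (2 ^ n) :=
        Finset.sum_le_sum fun g _ => card_filter_le_abs_kForrelationValue_snoc g ht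
    _ = 2 * Real.exp (-(t ^ 2 * 2 ^ n / 2)) * 2 ^ ((k + 1) * 2 ^ n) := by
        rw [Finset.sum_const, Finset.card_univ, Fintype.card_fun, Fintype.card_fun,
          Fintype.card_fun, Fintype.card_bool, Fintype.card_fin, Fintype.card_fin, nsmul_eq_mul]
        push_cast
        ring

/-- **Lemma 34 in the paper's normalisation** (`N = 2ⁿ`): for `s ≥ 0`,
`#{(f₁,…,f_{k+1}) : s/√N ≤ |Φ|} ≤ 2 e^{−s²/2} · 2^{(k+1)·2ⁿ}` — "`Pr[|Φ| ≥ s/√N]`" decays as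
`2e^{−s²/2}` (the printed bound is `O(1/sˢ)`).
[cite: AaronsonAmbainis2018, §9.1 Lemma 34 — variant (Hoeffding for Bennett)] -/
theorem card_filter_sqrt_le_abs_kForrelationValue (k n : ℕ) {s : ℝ} (hs : 0 ≤ s) :
    ((Finset.univ.filter fun f : Fin (k + 1) → (Fin n → Bool) → Bool =>
        s / Real.sqrt (2 ^ n) ≤ |kForrelationValue f|).card : ℝ) ≤
      2 * Real.exp (-(s ^ 2 / 2)) * 2 ^ ((k + 1) * 2 ^ n) := by
  have h := card_filter_le_abs_kForrelationValue k n (t := s / Real.sqrt (2 ^ n)) (by positivity)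
  have hexp : (s / Real.sqrt (2 ^ n)) ^ 2 * 2 ^ n / 2 = s ^ 2 / 2 := by
    rw [div_pow, Real.sq_sqrt (by positivity)]
    field_simp
  rwa [hexp] at h

end Literature.Computability.QuantumComplexity

end
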